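import Literature.AlgebraicGeometry.Resolution.Kuhlmann2019HenselianRationalityFiniteRankHolds
import Literature.AlgebraicGeometry.Resolution.Kuhlmann2019Prop52SepClosedHolds
import Literature.AlgebraicGeometry.Resolution.SeparablyDefectlessRationalVTHolds
import HarnessLib

/-!
# Henselian rationality (Kuhlmann 2019, Prop. 5.6 and Thm. 1.3): discharges

Topic: `Literature/AlgebraicGeometry/Resolution` (valued function fields). DISCHARGE file (no
definition, no new named fact) for the two named facts of F.-V. Kuhlmann, *Elimination of
ramification II: Henselian rationality*, Israel J. Math. 234 (2019) 927–958 = arXiv:1701.05508,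
vendored for a separably closed ground field:

* `Kuhlmann2019_Prop56_sepClosed` (`Kuhlmann2019HenselianRationalitySteps.lean`) — Prop. 5.6:
  "Every immediate separable function field `(F|K, v)` of transcendence degree 1 over a
  separably tame field `(K, v)` of finite rank is henselian rational."
* `Kuhlmann2019_Thm13_sepClosed` (`Kuhlmann2019HenselianRationality.lean`) — Thm. 1.3: "Let
  `(K, v)` be a separably tame field and `(F|K, v)` an immediate function field, with `F|K` a
  separable extension. If its transcendence degree over `K` is `1`, then `(F|K, v)` is henselian
  rational."

Every hypothesis of the PROVED reductions already in the tree has meanwhile been discharged: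
`Kuhlmann2019_Prop56_sepClosed.of_prop52_sepClosed`
(`Kuhlmann2019HenselianRationalityFiniteRankHolds.lean`) needs only
`Kuhlmann2019_Prop52_sepClosed`, proved as `Kuhlmann2019_Prop52_sepClosed_holds`
(`Kuhlmann2019Prop52SepClosedHolds.lean`); and
`Kuhlmann2019_Thm13_sepClosed.of_prop52_of_sepDefectless`
(`Kuhlmann2019HenselianRationalityFiniteRankAssembly.lean`) needs in addition the two clauses of
[16, Thm. 1] for rational function fields over separably closed fields, proved as
`Kuhlmann2010SeparablyDefectlessRational_sepClosed_holds`
(`SeparablyDefectlessRationalVTHolds.lean`) and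
`Kuhlmann2010SeparablyDefectlessRationalRT_sepClosed_holds`
(`SeparablyDefectlessRationalRTProofs.lean`).
This file only applies those terms; it is the bookkeeping step announced in the module
docstrings of the two `…FiniteRank{Assembly,Holds}` files ("the discharge … is this theorem
applied to `Kuhlmann2019_Prop52_sepClosed_holds` once that lands").

## Sources

* F.-V. Kuhlmann, *Elimination of ramification II: Henselian rationality*, Israel J. Math. 234
  (2019) 927–958 = arXiv:1701.05508: Thm. 1.3 (p. 2), Prop. 5.2 (p. 12), Prop. 5.6 (p. 13).
  [Kuhlmann2019]
* [16] = F.-V. Kuhlmann, *Elimination of ramification I: The generalized stability theorem*,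
  Trans. AMS 362 (2010) = arXiv:1003.5678: Thm. 1.1. [Kuhlmann2010]
-/

noncomputable section

namespace Literature.AlgebraicGeometry.Resolution

universe u

/-- **Kuhlmann 2019, Prop. 5.6 (separably closed ground field of finite rank), PROVED**:
`Kuhlmann2019_Prop56_sepClosed.of_prop52_sepClosed` fed with `Kuhlmann2019_Prop52_sepClosed_holds`.
[cite: Kuhlmann2019, Prop. 5.6] -/
theorem Kuhlmann2019_Prop56_sepClosed_holds : Kuhlmann2019_Prop56_sepClosed.{u} :=
  Kuhlmann2019_Prop56_sepClosed.of_prop52_sepClosed Kuhlmann2019_Prop52_sepClosed_holds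

/-- **Kuhlmann 2019, Thm. 1.3 (henselian rationality in transcendence degree `1`, separably
closed ground field), PROVED**: `Kuhlmann2019_Thm13_sepClosed.of_prop52_of_sepDefectless` fed
with `Kuhlmann2019_Prop52_sepClosed_holds`,
`Kuhlmann2010SeparablyDefectlessRational_sepClosed_holds` and
`Kuhlmann2010SeparablyDefectlessRationalRT_sepClosed_holds`. [cite: Kuhlmann2019, Thm. 1.3] -/
theorem Kuhlmann2019_Thm13_sepClosed_holds : Kuhlmann2019_Thm13_sepClosed.{u} :=
  Kuhlmann2019_Thm13_sepClosed.of_prop52_of_sepDefectless Kuhlmann2019_Prop52_sepClosed_holds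
    Kuhlmann2010SeparablyDefectlessRational_sepClosed_holds
    Kuhlmann2010SeparablyDefectlessRationalRT_sepClosed_holds

end Literature.AlgebraicGeometry.Resolution

end
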